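import Literature.NumberTheory.LFunctions.RieszTypeSeriesCriteria
import HarnessLib

/-!
# Splittings / NB — the Riesz-type SEQUENTIAL criterion (Báez-Duarte 2005) reproduces the NB trichotomy

Cell rh-split, seat rh-split-nb-neg g5 (card `SPLIT-nb-neg.md` §11; census row V26).

Báez-Duarte's coefficients `c_k = Σ_{j≤k} (−1)^j C(k,j)/ζ(2j+2)`
(`Literature.NumberTheory.LFunctions.baezDuarteCoeff`; exactly computable reals in `ℚ[π⁻²]`) carry
the printed criterion «RH ⟺ c_k ≪ k^{−3/4+ε} (∀ ε > 0)» (Thm 1.1), «c_k ≪ k^{−3/4} ⟹ all zeros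
simple» (Thm 1.1, simplicity clause) and «ζ ≠ 0 on Re s > 2(1−α) ⟺ c_k ≪ k^{−α+ε}» (Thm 1.2),
vendored as the NAMED FACTS `BaezDuarte2005_thm_1_1`, `BaezDuarte2005_thm_1_1_simple`,
`BaezDuarte2005_thm_1_2` (hypotheses here; published theorems).  A «finite check ∧ tail» splitting in
this family reads `FIN(H) ∧ TailBD(C,α,H)` with

  `TailBD(C,α,H) :≡ ∀ k ≥ H, |c_k| ≤ C·k^{−α}`,   `FIN(H) :≡` the finitely many inequalities `k < H`.

WHAT IS TYPED (modulo the three facts):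
* `isBigO_of_bdTail` — any tail is a `=O[atTop]` bound (the prefix is invisible to `O(·)`);
* `rh_and_simple_of_bdTail` — **`α = 3/4`, ε-free: `TailBD(C,3/4,H) ⟹ RH ∧ every zero of ζ simple`**
  — RH-PLUS, exactly as the sharp NB constant (`Splittings.NbSharpConstant.rh_and_simple_of_sharpRate`);
* `zeroFree_of_bdTail` — **`1/2 ≤ α ≤ 3/4`: `TailBD(C,α,H) ⟹ ζ ≠ 0 on Re s > 2(1−α)`**; for `α = 3/4−ε`
  this is quasi-RH(`1/2+2ε`) and NOT RH, so `FIN ∧ TailBD` does not reach RH at all (FIN is a list of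
  numerical facts about `k < H`);
* `rh_iff_bdTail_scheme` — the RH-EQUIVALENT is the ε-SCHEME `∀ ε > 0, ∃ C H, TailBD(C,3/4−ε… +ε,H)`
  with FREE `(C,H)` per `ε` — not a single tail statement; every fixed `(C,H,ε)` instance is either
  RH-plus (`ε = 0`) or short of RH (`ε > 0`).

SPLITTING READING (lens neg): in all three readings `FIN(H)` is decoration — the same verdict as the
NB rate/doubling tails (`CostumeDetectorsNbNeg`), in a second, independent parametrisation of the
Nyman–Beurling circle (Riesz/Hardy–Littlewood-type series); the costume theorem is not an artefact of
`d_N`.  No definitions; std axioms expected; the three facts enter as explicit hypotheses.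

References: L. Báez-Duarte, IJMMS 2005:21, 3527–3537 = arXiv:math/0307215, Thms 1.1–1.2
[corpus:paper:arxiv-math_0307215 p.1–3]; J. Cisło, M. Wolf, arXiv:math/0607782 (numerics of c_k)
[galaxy:pdf:-7165558636740549960]; K. Maślanka, arXiv:math-ph/0603713.

HONEST LABEL: «SPLITTING SEARCH over kernel-typed RH-EQUIVALENCES; a splitting A ∧ B ⟹ RH is
CONDITIONAL bookkeeping unless A and B are both proved; nothing here bears on the truth of RH.»
-/

noncomputable section

-- D-0017: `Summit.<S>.<S>.…` is the designed namespace of a single-problem summit.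
set_option linter.dupNamespace false

open Filter Topology Asymptotics

namespace Summit.RiemannHypothesis.RiemannHypothesis.Theorems.Splittings.NbRieszTails

open Literature.NumberTheory.LFunctions

/-- A tail bound `|c_k| ≤ C k^{−α}` for `k ≥ H` is a `=O` bound (the finite prefix is invisible).
[folklore] -/
theorem isBigO_of_bdTail {C α : ℝ} {H : ℕ}
    (h : ∀ k : ℕ, H ≤ k → |baezDuarteCoeff k| ≤ C * (k : ℝ) ^ (-α)) :
    (fun k : ℕ ↦ baezDuarteCoeff k) =O[atTop] fun k : ℕ ↦ (k : ℝ) ^ (-α) := by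
  refine isBigO_iff.2 ⟨C, eventually_atTop.2 ⟨H, fun k hk ↦ ?_⟩⟩
  rw [Real.norm_eq_abs, Real.norm_eq_abs, abs_of_nonneg (Real.rpow_nonneg (Nat.cast_nonneg k) _)]
  exact h k hk

/-- Monotonicity of the comparison scale: `k^{−α} = O(k^{−α+ε})` for `ε ≥ 0`. [folklore] -/
theorem isBigO_rpow_neg_add {α ε : ℝ} (hε : 0 ≤ ε) :
    (fun k : ℕ ↦ (k : ℝ) ^ (-α)) =O[atTop] fun k : ℕ ↦ (k : ℝ) ^ (-α + ε) := by
  refine isBigO_iff.2 ⟨1, eventually_atTop.2 ⟨1, fun k hk ↦ ?_⟩⟩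
  have hk1 : (1 : ℝ) ≤ k := by exact_mod_cast hk
  rw [Real.norm_eq_abs, Real.norm_eq_abs, abs_of_nonneg (Real.rpow_nonneg (Nat.cast_nonneg k) _),
    abs_of_nonneg (Real.rpow_nonneg (Nat.cast_nonneg k) _), one_mul]
  exact Real.rpow_le_rpow_of_exponent_le hk1 (by linarith)

/-- **nb/neg g5 (V26, `α = 3/4`, ε-free): the tail `∀ k ≥ H, |c_k| ≤ C k^{−3/4}` forces RH AND the
simplicity of every zero of `ζ`** — RH-PLUS, modulo Báez-Duarte 2005 Thm 1.1 and its simplicity clause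
(vendored facts, taken as hypotheses). [cite: BaezDuarte2005, Thm. 1.1 (with the simplicity clause)] -/
theorem rh_and_simple_of_bdTail (h11 : BaezDuarte2005_thm_1_1) (hs : BaezDuarte2005_thm_1_1_simple)
    {C : ℝ} {H : ℕ} (h : ∀ k : ℕ, H ≤ k → |baezDuarteCoeff k| ≤ C * (k : ℝ) ^ (-(3 / 4 : ℝ))) :
    RiemannHypothesis ∧ ∀ s : ℂ, riemannZeta s = 0 → deriv riemannZeta s ≠ 0 := by
  have hO := isBigO_of_bdTail h
  exact ⟨h11.2 fun _ hε ↦ hO.trans (isBigO_rpow_neg_add hε.le), hs hO⟩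

/-- **nb/neg g5 (V26, `1/2 ≤ α ≤ 3/4`): the tail `∀ k ≥ H, |c_k| ≤ C k^{−α}` gives zero-freeness on
`Re s > 2(1−α)` only** (Báez-Duarte 2005 Thm 1.2, as a hypothesis); for `α = 3/4 − ε` that is
quasi-RH(`1/2 + 2ε`), so `FIN ∧ TailBD(C,3/4−ε,H)` does NOT reach RH. [cite: BaezDuarte2005, Thm. 1.2] -/
theorem zeroFree_of_bdTail (h12 : BaezDuarte2005_thm_1_2) {α : ℝ} (hα : 1 / 2 ≤ α) (hα' : α ≤ 3 / 4)
    {C : ℝ} {H : ℕ} (h : ∀ k : ℕ, H ≤ k → |baezDuarteCoeff k| ≤ C * (k : ℝ) ^ (-α)) :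
    ∀ s : ℂ, 2 * (1 - α) < s.re → riemannZeta s ≠ 0 :=
  (h12 α hα hα').2 fun _ hε ↦ (isBigO_of_bdTail h).trans (isBigO_rpow_neg_add hε.le)

/-- **nb/neg g5 (V26, the scheme): the RH-equivalent in this family is `∀ ε > 0, ∃ C H, ∀ k ≥ H,
|c_k| ≤ C k^{−3/4+ε}`** — free `(C,H)` for every `ε`; no single `(C,α,H)` instance is an RH-equivalent
splitting (`ε = 0` is RH-plus by `rh_and_simple_of_bdTail`, `ε > 0` is short of RH by
`zeroFree_of_bdTail`). [cite: BaezDuarte2005, Thm. 1.1] -/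
theorem rh_iff_bdTail_scheme (h11 : BaezDuarte2005_thm_1_1) :
    RiemannHypothesis ↔ ∀ ε : ℝ, 0 < ε → ∃ C : ℝ, ∃ H : ℕ, ∀ k : ℕ, H ≤ k →
      |baezDuarteCoeff k| ≤ C * (k : ℝ) ^ (-(3 / 4 : ℝ) + ε) := by
  refine h11.trans (forall₂_congr fun ε _ ↦ ?_)
  rw [isBigO_iff]
  refine exists_congr fun C ↦ ?_
  rw [eventually_atTop]
  refine exists_congr fun H ↦ forall₂_congr fun k _ ↦ ?_
  rw [Real.norm_eq_abs, Real.norm_eq_abs, abs_of_nonneg (Real.rpow_nonneg (Nat.cast_nonneg k) _)]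

end Summit.RiemannHypothesis.RiemannHypothesis.Theorems.Splittings.NbRieszTails

end
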